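import Mathlib

/-!
# Route `TropicalKugaSatakeCayley`, support S5 `CayleyHodgeRankTwo` (stmt-HodgeConjecture-18573) — part A1:
# derivation calculus for constant alternating forms (integration of infinitesimal invariance)

Generic multilinear calculus on a real normed space `V`, for a continuous alternating form
`c : V [⋀^Fin k]→L[ℝ] ℂ` and the slotwise **derivation** `D_A c (w) = Σₘ c(w₁, …, A wₘ, …, w_k)` of an
operator `A` (written out as a sum, no new definition):

* `tkc_deriv_linear_sum` — `D` is linear in the operator (slot linearity);
* `tkc_rotation_of_deriv_zero` — **integration along a complex structure**: if `J` is linear with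
  `J² = -1` and `D_J c = 0` identically, then `c` is invariant under the rotations `cos θ + sin θ J`
  (the derivative of `θ ↦ c(e^{θJ} w)` is `(D_J c)(e^{θJ} w) = 0`; `is_const_of_deriv_eq_zero`);
* `tkc_unipotent_of_deriv_zero` — **integration along a square-zero operator**: if `N` is linear with
  `N² = 0` and `D_N c = 0` identically, then `c` is invariant under `1 + N`;
* `tkc_deriv_conj` — for `c` invariant under an invertible `A`, `D_{A⁻¹ B A} c (w) = D_B c (A w)`.

These are the tools by which the flatness (type `(p,p)` on every member of the Kuga–Satake family) of
an explicit constant form is reduced to finitely many derivation identities at the cusp (part A3).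
Theorems only; no definition, no named fact, no sorry.

## References

* [LangeBirkenhake1992] H. Lange, Ch. Birkenhake, Complex Abelian Varieties (1992), §1.1.5 (forms of
  type `(p,q)` as weight vectors of the circle action).
* [vanGeemenVerra2003QuaternionicPryms] B. van Geemen, A. Verra, Quaternionic Pryms and Hodge classes,
  Topology 42 (2003), §6.1 (Hodge classes as invariants of the Hodge group / its Lie algebra).
-/

noncomputable section

set_option linter.dupNamespace false

namespace Summit.HodgeConjecture.HodgeConjecture.Theorems

section DerivationCalculus

variable {V : Type*} [NormedAddCommGroup V] [NormedSpace ℝ V] {k : ℕ}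

/-- **`D` is additive in the operator**: `D_{A+B} c = D_A c + D_B c` (slotwise). [folklore] -/
theorem tkc_deriv_add (c : V [⋀^Fin k]→L[ℝ] ℂ) (A B : V → V) (w : Fin k → V) :
    ∑ m, c (Function.update w m (A (w m) + B (w m))) =
      ∑ m, c (Function.update w m (A (w m))) + ∑ m, c (Function.update w m (B (w m))) := by
  classical
  rw [← Finset.sum_add_distrib]
  exact Finset.sum_congr rfl fun m _ => c.map_update_add w m (A (w m)) (B (w m))

/-- **`D` is homogeneous in the operator**: `D_{a A} c = a D_A c` (slotwise). [folklore] -/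
theorem tkc_deriv_smul (c : V [⋀^Fin k]→L[ℝ] ℂ) (A : V → V) (a : ℝ) (w : Fin k → V) :
    ∑ m, c (Function.update w m (a • A (w m))) = a • ∑ m, c (Function.update w m (A (w m))) := by
  classical
  rw [Finset.smul_sum]
  exact Finset.sum_congr rfl fun m _ => c.map_update_smul w m a (A (w m))

/-- **`D` of a negated operator.** [folklore] -/
theorem tkc_deriv_neg (c : V [⋀^Fin k]→L[ℝ] ℂ) (A : V → V) (w : Fin k → V) :
    ∑ m, c (Function.update w m (-A (w m))) = -∑ m, c (Function.update w m (A (w m))) := by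
  classical
  have h := tkc_deriv_smul c A (-1) w
  simp only [neg_smul, one_smul] at h
  exact h

/-- **`D` is linear in the operator over finite sums**: `D_{Σ aᵢ Aᵢ} c = Σ aᵢ D_{Aᵢ} c`; in particular
it vanishes when every `D_{Aᵢ} c` does. [folklore] -/
theorem tkc_deriv_linear_sum {ι : Type*} (s : Finset ι) (c : V [⋀^Fin k]→L[ℝ] ℂ) (A : ι → V → V)
    (a : ι → ℝ) (hA : ∀ i ∈ s, ∀ w : Fin k → V, ∑ m, c (Function.update w m (A i (w m))) = 0)
    (w : Fin k → V) : ∑ m, c (Function.update w m (∑ i ∈ s, a i • A i (w m))) = 0 := by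
  classical
  induction s using Finset.induction_on with
  | empty =>
    simp only [Finset.sum_empty]
    have : ∀ m, c (Function.update w m (0 : V)) = 0 := fun m => c.map_update_zero w m
    simp [this]
  | insert i s hi ih =>
    simp_rw [Finset.sum_insert hi]
    have hadd := tkc_deriv_add c (fun v => a i • A i v) (fun v => ∑ i' ∈ s, a i' • A i' v) w
    have hsm := tkc_deriv_smul c (A i) (a i) w
    rw [hadd, hsm, hA i (Finset.mem_insert_self i s) w, smul_zero, zero_add]
    exact ih fun i' hi' => hA i' (Finset.mem_insert_of_mem hi')

/-- **Integration along a complex structure.** If `J` is a continuous linear operator with `J² = -1`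
and the derivation `D_J c` vanishes identically, then `c` is invariant under the rotations
`e^{θJ} = cos θ + sin θ J`: the function `θ ↦ c(e^{θJ} w)` has derivative `(D_J c)(e^{θJ} w) = 0`.
[cite: LangeBirkenhake1992, §1.1.5] -/
theorem tkc_rotation_of_deriv_zero (c : V [⋀^Fin k]→L[ℝ] ℂ) (J : V →L[ℝ] V)
    (hJ : ∀ v, J (J v) = -v)
    (h : ∀ w : Fin k → V, ∑ m, c (Function.update w m (J (w m))) = 0)
    (θ : ℝ) (w : Fin k → V) :
    c (fun m => Real.cos θ • w m + Real.sin θ • J (w m)) = c w := by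
  classical
  set g : ℝ → (Fin k → V) := fun s m => Real.cos s • w m + Real.sin s • J (w m) with hg
  have hgd : ∀ s, HasDerivAt g (fun m => J (g s m)) s := by
    intro s
    rw [hasDerivAt_pi]
    intro m
    have h1 : HasDerivAt (fun s : ℝ => Real.cos s • w m) ((-Real.sin s) • w m) s :=
      (Real.hasDerivAt_cos s).smul_const (w m)
    have h2 : HasDerivAt (fun s : ℝ => Real.sin s • J (w m)) ((Real.cos s) • J (w m)) s :=
      (Real.hasDerivAt_sin s).smul_const (J (w m))
    have h12 := h1.add h2
    have hJg : J (g s m) = (-Real.sin s) • w m + Real.cos s • J (w m) := by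
      simp only [hg, map_add, map_smul, hJ, smul_neg, neg_smul]
      abel
    rw [hJg]
    exact h12
  have hF : ∀ s, HasDerivAt (fun s => c (g s)) (0 : ℂ) s := by
    intro s
    have hc : HasFDerivAt (⇑c.toContinuousMultilinearMap)
        (c.toContinuousMultilinearMap.linearDeriv (g s)) (g s) :=
      c.toContinuousMultilinearMap.hasFDerivAt (g s)
    have hcomp := hc.comp_hasDerivAt s (hgd s)
    rw [ContinuousMultilinearMap.linearDeriv_apply] at hcomp
    simp only [ContinuousAlternatingMap.coe_toContinuousMultilinearMap] at hcomp
    rw [h (g s)] at hcomp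
    exact hcomp
  have hdiff : Differentiable ℝ (fun s => c (g s)) := fun s => (hF s).differentiableAt
  have hderiv : ∀ s, deriv (fun s => c (g s)) s = 0 := fun s => (hF s).deriv
  have hconst := is_const_of_deriv_eq_zero hdiff hderiv θ 0
  have hg0 : g 0 = w := by
    funext m
    simp [hg]
  rw [hg0] at hconst
  exact hconst

/-- **Integration along a square-zero operator.** If `N` is a continuous linear operator with `N² = 0`
and `D_N c` vanishes identically, then `c` is invariant under the unipotent operator `1 + N`: the
function `s ↦ c((1 + sN) w)` has derivative `(D_N c)((1 + sN) w) = 0`. [folklore] -/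
theorem tkc_unipotent_of_deriv_zero (c : V [⋀^Fin k]→L[ℝ] ℂ) (N : V →L[ℝ] V)
    (hN : ∀ v, N (N v) = 0)
    (h : ∀ w : Fin k → V, ∑ m, c (Function.update w m (N (w m))) = 0)
    (w : Fin k → V) :
    c (fun m => w m + N (w m)) = c w := by
  classical
  set g : ℝ → (Fin k → V) := fun s m => w m + s • N (w m) with hg
  have hgd : ∀ s, HasDerivAt g (fun m => N (g s m)) s := by
    intro s
    rw [hasDerivAt_pi]
    intro m
    have h1 : HasDerivAt (fun s : ℝ => s • N (w m)) ((1 : ℝ) • N (w m)) s :=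
      (hasDerivAt_id s).smul_const (N (w m))
    have h2 := h1.const_add (w m)
    have hNg : N (g s m) = (1 : ℝ) • N (w m) := by
      simp only [hg, map_add, map_smul, hN, smul_zero, add_zero, one_smul]
    rw [hNg]
    exact h2
  have hF : ∀ s, HasDerivAt (fun s => c (g s)) (0 : ℂ) s := by
    intro s
    have hc : HasFDerivAt (⇑c.toContinuousMultilinearMap)
        (c.toContinuousMultilinearMap.linearDeriv (g s)) (g s) :=
      c.toContinuousMultilinearMap.hasFDerivAt (g s)
    have hcomp := hc.comp_hasDerivAt s (hgd s)
    rw [ContinuousMultilinearMap.linearDeriv_apply] at hcomp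
    simp only [ContinuousAlternatingMap.coe_toContinuousMultilinearMap] at hcomp
    rw [h (g s)] at hcomp
    exact hcomp
  have hdiff : Differentiable ℝ (fun s => c (g s)) := fun s => (hF s).differentiableAt
  have hderiv : ∀ s, deriv (fun s => c (g s)) s = 0 := fun s => (hF s).deriv
  have hconst := is_const_of_deriv_eq_zero hdiff hderiv 1 0
  have hg0 : g 0 = w := by
    funext m
    simp [hg]
  have hg1 : g 1 = fun m => w m + N (w m) := by
    funext m
    simp [hg]
  rw [hg0, hg1] at hconst
  exact hconst

/-- **Conjugation.** If `c` is invariant under an invertible operator `A` (slotwise), then the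
derivation of the conjugate `A⁻¹ B A` at `w` is the derivation of `B` at `A w`:
`D_{A⁻¹BA} c (w) = D_B c (A ∘ w)`. [folklore] -/
theorem tkc_deriv_conj (c : V [⋀^Fin k]→L[ℝ] ℂ) (A Ainv B : V → V)
    (hA : ∀ u : Fin k → V, c (fun m => A (u m)) = c u) (hAinv : ∀ v, A (Ainv v) = v)
    (w : Fin k → V) :
    ∑ m, c (Function.update w m (Ainv (B (A (w m))))) =
      ∑ m, c (Function.update (fun m => A (w m)) m (B (A (w m)))) := by
  classical
  refine Finset.sum_congr rfl fun m _ => ?_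
  rw [← hA (Function.update w m (Ainv (B (A (w m)))))]
  congr 1
  funext m'
  by_cases hm : m' = m
  · subst hm
    simp [hAinv]
  · simp [Function.update_of_ne hm]

end DerivationCalculus

end Summit.HodgeConjecture.HodgeConjecture.Theorems

end
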